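import Mathlib.Algebra.BigOperators.Fin
import Mathlib.Data.Real.Basic
import Mathlib.Logic.Equiv.Fin.Basic
import Mathlib.Order.Interval.Set.Basic
import HarnessLib

/-!
# Ladder engine: the coordinate swap (crux `HurwitzSectorComplement`, line `chebyshev-level-deformation`,
# stub S1 `stub_ladderEngine` — index bookkeeping)

After the first Newton–Leibniz move of a ladder step the representation lives on the band
`(x₀,…,x_{m+1}, y₀,…,y_{k−1}, y′) ∈ ℝ^{m+2+k+1}` (box block, parameter block, new parameter LAST). The
second move integrates out the LAST BOX coordinate `x_{m+1}`, which must first be moved to the end: we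
relabel by the transposition `e = swap(position of x_{m+1}, last) ∘ cast`, read as an equivalence
`Fin (m+2+k+1) ≃ Fin (m+1+(k+1)+1)`, so that in the new coordinates `w′` the old ones are `i ↦ w′ (e i)`
(the convention of `KZ.IntegralRep.reindex`). In the new layout the blocks are
`(x₀,…,x_m | y′, y₀,…,y_{k−1} | x_{m+1})`: the new parameter has become the FIRST coordinate of the
parameter block. This file is pure `Fin` arithmetic (no measure theory): where each old coordinate is
read (`reindex_apply_*`), the resulting description of the transported open band
(`reindex_band_iff`) and the splitting of the product of the old box coordinates (`reindex_prod`).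
-/

namespace Summit.KontsevichZagierPeriods.Theorems.HurwitzMicroSectorsHurwitzSectorComplement.LadderEngine

variable {m k : ℕ}

/-- The old box coordinate `xᵢ`, `i ≤ m`, is read at the new position `i`. [folklore] -/
theorem reindex_apply_box (w' : Fin (m + 1 + (k + 1) + 1) → ℝ) (i : Fin (m + 1)) :
    w' (((Equiv.swap (Fin.castSucc (Fin.castAdd k (Fin.last (m + 1)))) (Fin.last (m + 2 + k))).trans
        (finCongr (show m + 2 + k + 1 = m + 1 + (k + 1) + 1 by omega)))
      (Fin.castSucc (Fin.castAdd k (Fin.castSucc i)))) =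
    w' (Fin.castSucc (Fin.castAdd (k + 1) i)) := by
  congr 1
  rw [Equiv.trans_apply, Equiv.swap_apply_of_ne_of_ne]
  · exact Fin.ext rfl
  · intro h
    have := congrArg Fin.val h
    simp at this
    omega
  · intro h
    have := congrArg Fin.val h
    simp at this
    omega

/-- The old last box coordinate `x_{m+1}` is read at the new LAST position. [folklore] -/
theorem reindex_apply_lastBox (w' : Fin (m + 1 + (k + 1) + 1) → ℝ) :
    w' (((Equiv.swap (Fin.castSucc (Fin.castAdd k (Fin.last (m + 1)))) (Fin.last (m + 2 + k))).trans
        (finCongr (show m + 2 + k + 1 = m + 1 + (k + 1) + 1 by omega)))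
      (Fin.castSucc (Fin.castAdd k (Fin.last (m + 1))))) =
    w' (Fin.last (m + 1 + (k + 1))) := by
  congr 1
  rw [Equiv.trans_apply, Equiv.swap_apply_left]
  exact Fin.ext (by simp)

/-- The old parameter `yⱼ` is read at the new position `m + 1 + (j + 1)` (the `(j+1)`-st slot of the new
parameter block). [folklore] -/
theorem reindex_apply_param (w' : Fin (m + 1 + (k + 1) + 1) → ℝ) (j : Fin k) :
    w' (((Equiv.swap (Fin.castSucc (Fin.castAdd k (Fin.last (m + 1)))) (Fin.last (m + 2 + k))).trans
        (finCongr (show m + 2 + k + 1 = m + 1 + (k + 1) + 1 by omega)))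
      (Fin.castSucc (Fin.natAdd (m + 2) j))) =
    w' (Fin.castSucc (Fin.natAdd (m + 1) j.succ)) := by
  congr 1
  rw [Equiv.trans_apply, Equiv.swap_apply_of_ne_of_ne]
  · exact Fin.ext (by simp; omega)
  · intro h
    have := congrArg Fin.val h
    simp at this
    omega
  · intro h
    have := congrArg Fin.val h
    simp at this
    omega

/-- The old band variable (old LAST coordinate) is read at the new position `m + 1` (the FIRST slot of the
new parameter block). [folklore] -/
theorem reindex_apply_bandVar (w' : Fin (m + 1 + (k + 1) + 1) → ℝ) :
    w' (((Equiv.swap (Fin.castSucc (Fin.castAdd k (Fin.last (m + 1)))) (Fin.last (m + 2 + k))).trans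
        (finCongr (show m + 2 + k + 1 = m + 1 + (k + 1) + 1 by omega)))
      (Fin.last (m + 2 + k))) =
    w' (Fin.castSucc (Fin.natAdd (m + 1) 0)) := by
  congr 1
  rw [Equiv.trans_apply, Equiv.swap_apply_right]
  exact Fin.ext (by simp)

/-- The product of the old box coordinates, read in the new coordinates: the first `m + 1` new box
coordinates times the new last coordinate. [folklore] -/
theorem reindex_prod (w' : Fin (m + 1 + (k + 1) + 1) → ℝ) :
    (∏ i : Fin (m + 2), (fun idx : Fin (m + 2 + k + 1) => w'
        (((Equiv.swap (Fin.castSucc (Fin.castAdd k (Fin.last (m + 1)))) (Fin.last (m + 2 + k))).trans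
          (finCongr (show m + 2 + k + 1 = m + 1 + (k + 1) + 1 by omega))) idx))
      (Fin.castSucc (Fin.castAdd k i))) =
    (∏ i : Fin (m + 1), w' (Fin.castSucc (Fin.castAdd (k + 1) i))) * w' (Fin.last (m + 1 + (k + 1))) := by
  rw [Fin.prod_univ_castSucc]
  simp only [reindex_apply_box, reindex_apply_lastBox]

/-- **The transported open band.** For the old open band
`{w | init w ∈ box^{m+2} × D, 0 < w_last < lam(y(init w))}` and new coordinates `w′`
(`old i ↦ w′ (e i)`): membership says exactly that `init w′` lies in the advanced base
`box^{m+1} × D⁺` (`D⁺ = {y′ | tail y′ ∈ D, 0 < y′₀ < lam(tail y′)}`) and `0 < w′_last < 1`. [folklore] -/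
theorem reindex_band_iff (D : Set (Fin k → ℝ)) (lam : (Fin k → ℝ) → ℝ)
    (w' : Fin (m + 1 + (k + 1) + 1) → ℝ) :
    ((fun idx : Fin (m + 2 + k + 1) => w'
        (((Equiv.swap (Fin.castSucc (Fin.castAdd k (Fin.last (m + 1)))) (Fin.last (m + 2 + k))).trans
          (finCongr (show m + 2 + k + 1 = m + 1 + (k + 1) + 1 by omega))) idx)) ∈
      {w : Fin (m + 2 + k + 1) → ℝ |
        (Fin.init w : Fin (m + 2 + k) → ℝ) ∈ {z : Fin (m + 2 + k) → ℝ |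
          (∀ i : Fin (m + 2), z (Fin.castAdd k i) ∈ Set.Ioo (0:ℝ) 1) ∧
          (fun j : Fin k => z (Fin.natAdd (m + 2) j)) ∈ D} ∧
        0 < w (Fin.last (m + 2 + k)) ∧
        w (Fin.last (m + 2 + k)) < lam (fun j : Fin k => (Fin.init w : Fin (m + 2 + k) → ℝ) (Fin.natAdd (m + 2) j))}) ↔
    ((Fin.init w' : Fin (m + 1 + (k + 1)) → ℝ) ∈ {z : Fin (m + 1 + (k + 1)) → ℝ |
        (∀ i : Fin (m + 1), z (Fin.castAdd (k + 1) i) ∈ Set.Ioo (0:ℝ) 1) ∧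
        (fun j : Fin k => z (Fin.natAdd (m + 1) j.succ)) ∈ D ∧
        0 < z (Fin.natAdd (m + 1) 0) ∧
        z (Fin.natAdd (m + 1) 0) < lam (fun j : Fin k => z (Fin.natAdd (m + 1) j.succ))} ∧
      0 < w' (Fin.last (m + 1 + (k + 1))) ∧ w' (Fin.last (m + 1 + (k + 1))) < 1) := by
  simp only [Set.mem_setOf_eq, Fin.init, reindex_apply_param, reindex_apply_bandVar, Set.mem_Ioo]
  constructor
  · rintro ⟨⟨hbox, hD⟩, hpos, hlt⟩
    refine ⟨⟨fun i => ?_, hD, hpos, hlt⟩, ?_, ?_⟩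
    · simpa only [reindex_apply_box] using hbox (Fin.castSucc i)
    · simpa only [reindex_apply_lastBox] using (hbox (Fin.last (m + 1))).1
    · simpa only [reindex_apply_lastBox] using (hbox (Fin.last (m + 1))).2
  · rintro ⟨⟨hbox, hD, hpos, hlt⟩, h0, h1⟩
    refine ⟨⟨fun i => ?_, hD⟩, hpos, hlt⟩
    refine Fin.lastCases ?_ (fun i' => ?_) i
    · simpa only [reindex_apply_lastBox] using And.intro h0 h1
    · simpa only [reindex_apply_box] using hbox i'

end Summit.KontsevichZagierPeriods.Theorems.HurwitzMicroSectorsHurwitzSectorComplement.LadderEngine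

namespace Summit.KontsevichZagierPeriods.Theorems.HurwitzMicroSectorsHurwitzSectorComplement

/-- **Registered sub-goal of `stub_ladderEngine` (coordinate swap).** In the coordinates after the swap
`e = swap(position of x_{m+1}, last) ∘ cast : Fin (m+2+k+1) ≃ Fin (m+1+(k+1)+1)`, the old open band over
`box^{m+2} × D` with band variable in `(0, lam y)` is the open band `(0,1)` in the last coordinate over the
advanced base `box^{m+1} × D⁺`. [folklore] -/
theorem ladderEngine_reindexBand :
    ∀ (m k : ℕ) (D : Set (Fin k → ℝ)) (lam : (Fin k → ℝ) → ℝ) (w' : Fin (m + 1 + (k + 1) + 1) → ℝ),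
    ((fun idx : Fin (m + 2 + k + 1) => w'
        (((Equiv.swap (Fin.castSucc (Fin.castAdd k (Fin.last (m + 1)))) (Fin.last (m + 2 + k))).trans
          (finCongr (show m + 2 + k + 1 = m + 1 + (k + 1) + 1 by omega))) idx)) ∈
      {w : Fin (m + 2 + k + 1) → ℝ |
        (Fin.init w : Fin (m + 2 + k) → ℝ) ∈ {z : Fin (m + 2 + k) → ℝ |
          (∀ i : Fin (m + 2), z (Fin.castAdd k i) ∈ Set.Ioo (0:ℝ) 1) ∧
          (fun j : Fin k => z (Fin.natAdd (m + 2) j)) ∈ D} ∧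
        0 < w (Fin.last (m + 2 + k)) ∧
        w (Fin.last (m + 2 + k)) < lam (fun j : Fin k => (Fin.init w : Fin (m + 2 + k) → ℝ) (Fin.natAdd (m + 2) j))}) ↔
    ((Fin.init w' : Fin (m + 1 + (k + 1)) → ℝ) ∈ {z : Fin (m + 1 + (k + 1)) → ℝ |
        (∀ i : Fin (m + 1), z (Fin.castAdd (k + 1) i) ∈ Set.Ioo (0:ℝ) 1) ∧
        (fun j : Fin k => z (Fin.natAdd (m + 1) j.succ)) ∈ D ∧
        0 < z (Fin.natAdd (m + 1) 0) ∧
        z (Fin.natAdd (m + 1) 0) < lam (fun j : Fin k => z (Fin.natAdd (m + 1) j.succ))} ∧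
      0 < w' (Fin.last (m + 1 + (k + 1))) ∧ w' (Fin.last (m + 1 + (k + 1))) < 1) :=
  fun _ _ D lam w' => LadderEngine.reindex_band_iff D lam w'

end Summit.KontsevichZagierPeriods.Theorems.HurwitzMicroSectorsHurwitzSectorComplement
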